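import Mathlib
import Summits.QuantumFields.BalabanUV.Beta.EriceRemainderEnclosureHistoryAutonomyComparisonAgeCompositionStaticChainCertificate

/-!
# EriceRemainderEnclosureHistoryAutonomyComparisonAgeCompositionStaticChainCrossAmplifications — (E78h) THE CROSS AMPLIFICATIONS OF A CLOSE OBSERVER PAIR FROM THE
# RESPONSES ALONE: the response to a near-proportional source is near-proportional, hence the sandwich `Ψ_yz ∈ [α₋,α₊]Ψ_yy`, `Ψ_zy ∈ [β₋,β₊]Ψ_yy`,
# `Ψ_zz ∈ [α₋β₋, α₊β₊]Ψ_yy` and BOTH covariance bounds `|Ψ_yyΨ_zz − Ψ_yzΨ_zy| ≤ ΔαΔβΨ_yy²` with SINGLE sums — no resolvent matrix — i.e. exactly the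
# hypotheses of (E78g) `adjacent_step` for an actual configuration

Cell `pub-balaban`, β-function sub-cell, BINDER row D4 «RemainderConst leaves for Bałaban's split» (`HOME/BINDER-OWNERS.md`; owner lineage `b2b-balaban-beta-an4`;
this file by co-owner #2 lineage `b2b-balaban-beta-d4-p2`, generation 69), β-FLOW TEAM duty (1), FREEZE (0) honoured (def-free; imports (E78a) `…StaticChainCertificate`
(`response_mono`); nothing restated).

HONEST FRAMING (page 1, verbatim and binding).  *"Discharging BetaPertH makes Bałaban's UV stability UNCONDITIONAL — a real constructive-QFT result; it is
NOT the continuum limit and NOT the Clay problem."*  THIS FILE DISCHARGES NOTHING OF THE KIND.  Elementary algebra of finite sums — hypotheses of a census, not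
facts; the age profile of Bałaban's (1.22) limit functional is NOT PRINTED ([I] p. 298; GAPS G-t4-U2-1∕-2) and NOT asserted.  Row D4 class UNCHANGED (critical-path
width 0; instance 0∕1; D4 DISCHARGE NO DATE).  HONEST DEPENDENCY: continuum YM on T⁴ ⇐ BetaPertH ∧ nine spine estimates (0/9 proved); BetaPertH ⇐ (D1) ∧ (D4) ∧
CAP+tail; G-an2-4 gates asym, D1 and NE2/3/4.

THE POINT (census sense (α); route (N′); README `HOME/b2b-balaban-beta-d4-p2/g69/e78/README.md` §5–§6).  (E78b) `covariance_bound` ∕ (E78f) `covariance_bound_rev` are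
stated for a double-sum kernel `W_{il} = (e_y)_iR_{il}φ^y_l` — but the resolvent `R` is not an object of the def-free census.  This file removes it: with `cy`, `cz`
the exact responses of the old system to the reads `φ^y`, `φ^z` of the two observers, §1 **`response_ratio_bounds`**: `β₋φ^y ≤ φ^z ≤ β₊φ^y` componentwise ⟹
`β₋cy ≤ cz ≤ β₊cy` (scaled responses solve scaled systems; (E78a) `response_mono`); §2 **`cross_gram_bounds`**: writing `Ψ_yy = Σe_icy_i`, `Ψ_yz = Σα_ie_icy_i`,
`Ψ_zy = Σe_icz_i`, `Ψ_zz = Σα_ie_icz_i` (`α_i = σ_i(z)∕σ_i(y) ∈ [α₋,α₊]`), the sandwich and the two covariance bounds follow from the one-line identity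
`Ψ_yyΨ_zz − Ψ_yzΨ_zy = Ψ_yy·X − Y·Z` (`X, Y, Z` the shifted sums, each with an explicit range).  With (E78c) `charge_ratio_ge`∕`readWindow_mono_right` (`α ∈ [z∕(z+1), 1]`),
`read_ratio_ge` and (E78f) `read_ratio_le` (`β ∈ [1, 1.0607]` for `z ≥ 16`), every resolvent-side hypothesis of (E78g) `adjacent_step` is an elementary fact about the
configuration's responses.  NOT CLAIMED: the lattice wiring as one theorem; `z ≤ 15`; non-adjacent pairs; the assembly; the static closure; the flow; printed.

WHAT IS PROVED ([folklore]; 0 `def`, 0 sorry).  §1 **`response_ratio_bounds`**.  §2 **`cross_gram_bounds`**.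
-/
noncomputable section
open Finset

namespace Summit.QuantumFields.BalabanUV.Beta.EriceRemainderEnclosureHistoryAutonomyComparisonAgeCompositionStaticChainCrossAmplifications

open Summit.QuantumFields.BalabanUV.Beta.EriceRemainderEnclosureHistoryAutonomyComparisonAgeCompositionStaticChainCertificate

variable {n : ℕ} {G : ℕ → ℕ → ℝ} {a cy cz φy φz ey α : ℕ → ℝ} {βl Δβ αl Δα : ℝ}

/-! ## §1 The response to a near-proportional source is near-proportional -/

/-- **RESPONSE RATIO BOUNDS.**  Old system `G ≥ 0` with positive levels; `cy` the exact response to the source `φ^y ≥ 0`, `cz` the exact response to `φ^z` with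
`β₋φ^y ≤ φ^z ≤ (β₋+Δβ)φ^y` componentwise (`β₋, Δβ ≥ 0`).  Then **`β₋·cy ≤ cz ≤ (β₋+Δβ)·cy`** componentwise: scaled responses solve the scaled systems, and responses
are monotone in the source ((E78a) `response_mono`).  THE USE: `φ^y_i = S_{y,k_i}∕y`, `φ^z_i = S_{z,k_i}∕z`, `β_i = φ^z_i∕φ^y_i ∈ [β₋, β₋+Δβ]` by (E78c) `read_ratio_ge` ∕
`read_ratio_antitone` (or the crude `[1, 1.0607]` of (E78f)). [folklore] -/
theorem response_ratio_bounds (hG : ∀ i l, i < n → l < n → 0 ≤ G i l) (ha : ∀ i, i < n → 0 < a i)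
    (hlev : ∀ i, i < n → 1 + ∑ l ∈ range n, G i l * a l ≤ a i)
    (hcy : ∀ i, i < n → cy i = φy i + ∑ l ∈ range n, G i l * cy l)
    (hcz : ∀ i, i < n → cz i = φz i + ∑ l ∈ range n, G i l * cz l)
    (hlo : ∀ i, i < n → βl * φy i ≤ φz i) (hhi : ∀ i, i < n → φz i ≤ (βl + Δβ) * φy i) :
    ∀ i, i < n → βl * cy i ≤ cz i ∧ cz i ≤ (βl + Δβ) * cy i := by
  have hscaled : ∀ (t : ℝ), ∀ i, i < n → t * cy i = t * φy i + ∑ l ∈ range n, G i l * (t * cy l) := by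
    intro t i hi
    have : ∑ l ∈ range n, G i l * (t * cy l) = t * ∑ l ∈ range n, G i l * cy l := by
      rw [mul_sum]; exact sum_congr rfl fun l _ => by ring
    rw [this, hcy i hi]; ring
  have h1 := response_mono (u := fun i => βl * cy i) (w := fun i => βl * φy i) (u' := cz) (w' := φz) hG ha hlev hlo (hscaled βl) hcz
  have h2 := response_mono (u := cz) (w := φz) (u' := fun i => (βl + Δβ) * cy i) (w' := fun i => (βl + Δβ) * φy i) hG ha hlev hhi hcz (hscaled (βl + Δβ))
  exact fun i hi => ⟨h1 i hi, h2 i hi⟩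

/-! ## §2 The four cross amplifications: sandwich and the two covariance bounds, with single sums -/

/-- **THE CROSS GRAM OF A CLOSE OBSERVER PAIR, WITHOUT THE RESOLVENT.**  Letters: `w_i := e_i·cy_i ≥ 0` the summands of `Ψ_yy = Σ_i e_i cy_i` (`e_i = 2x_iσ_i(y) ≥ 0`,
`cy ≥ 0`); charge ratios `α_i ∈ [α₋, α₋+Δα]` (`(e_z)_i = α_i e_i`; `α₋, Δα ≥ 0`); response ratios `β₋cy_i ≤ cz_i ≤ (β₋+Δβ)cy_i` (`response_ratio_bounds`; `β₋ ≥ 0`).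
With `Ψ_yz = Σ α_i e_i cy_i`, `Ψ_zy = Σ e_i cz_i`, `Ψ_zz = Σ α_i e_i cz_i`: the SANDWICH `Ψ_yz ∈ [α₋, α₋+Δα]Ψ_yy`, `Ψ_zy ∈ [β₋, β₋+Δβ]Ψ_yy`,
`Ψ_zz ∈ [α₋β₋, (α₋+Δα)(β₋+Δβ)]Ψ_yy`, and BOTH COVARIANCE BOUNDS `|Ψ_yyΨ_zz − Ψ_yzΨ_zy| ≤ ΔαΔβΨ_yy²` (the identity `Ψ_yyΨ_zz − Ψ_yzΨ_zy = Ψ_yy·X − Y·Z` with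
`X = Σ(α_i−α₋)e_i(cz_i − β₋cy_i) ∈ [0, ΔαZ]`, `Y = Ψ_yz − α₋Ψ_yy ∈ [0, ΔαΨ_yy]`, `Z = Ψ_zy − β₋Ψ_yy ∈ [0, ΔβΨ_yy]`).  These are exactly the hypotheses `hyz*`, `hzy*`, `hzz*`,
`hcov*` of (E78g) `adjacent_step` (there `α₋ = 16∕17`, `Δα = 1∕17`, `β₋ = 1`, `Δβ = 0.0607`, `ΔαΔβ ≤ 9∕2500`). [folklore] -/
theorem cross_gram_bounds (he : ∀ i, i < n → 0 ≤ ey i) (hcy0 : ∀ i, i < n → 0 ≤ cy i)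
    (hα : ∀ i, i < n → αl ≤ α i ∧ α i ≤ αl + Δα) (hαl : 0 ≤ αl) (hΔα : 0 ≤ Δα)
    (hcz : ∀ i, i < n → βl * cy i ≤ cz i ∧ cz i ≤ (βl + Δβ) * cy i) (hβl : 0 ≤ βl) :
    let Pyy := ∑ i ∈ range n, ey i * cy i
    let Pyz := ∑ i ∈ range n, α i * ey i * cy i
    let Pzy := ∑ i ∈ range n, ey i * cz i
    let Pzz := ∑ i ∈ range n, α i * ey i * cz i
    (αl * Pyy ≤ Pyz ∧ Pyz ≤ (αl + Δα) * Pyy) ∧ (βl * Pyy ≤ Pzy ∧ Pzy ≤ (βl + Δβ) * Pyy) ∧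
      (αl * βl * Pyy ≤ Pzz ∧ Pzz ≤ (αl + Δα) * (βl + Δβ) * Pyy) ∧
      (Pyy * Pzz - Pyz * Pzy ≤ Δα * Δβ * Pyy ^ 2 ∧ Pyz * Pzy - Pyy * Pzz ≤ Δα * Δβ * Pyy ^ 2) := by
  intro Pyy Pyz Pzy Pzz
  -- the shifted sums
  set Y := ∑ i ∈ range n, (α i - αl) * (ey i * cy i) with hY
  set Z := ∑ i ∈ range n, ey i * (cz i - βl * cy i) with hZ
  set X := ∑ i ∈ range n, (α i - αl) * (ey i * (cz i - βl * cy i)) with hX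
  have hw0 : ∀ i ∈ range n, 0 ≤ ey i * cy i := fun i hi => mul_nonneg (he i (mem_range.mp hi)) (hcy0 i (mem_range.mp hi))
  have hd0 : ∀ i ∈ range n, 0 ≤ ey i * (cz i - βl * cy i) := fun i hi =>
    mul_nonneg (he i (mem_range.mp hi)) (by linarith [(hcz i (mem_range.mp hi)).1])
  have hPyy0 : 0 ≤ Pyy := sum_nonneg hw0
  -- identities
  have eY : Pyz = Y + αl * Pyy := by
    simp only [Pyz, hY, Pyy, mul_sum, ← sum_add_distrib]; exact sum_congr rfl fun i _ => by ring
  have eZ : Pzy = Z + βl * Pyy := by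
    simp only [Pzy, hZ, Pyy, mul_sum, ← sum_add_distrib]; exact sum_congr rfl fun i _ => by ring
  have eX : Pzz = X + αl * Z + βl * Y + αl * βl * Pyy := by
    simp only [Pzz, hX, hZ, hY, Pyy, mul_sum, ← sum_add_distrib]; exact sum_congr rfl fun i _ => by ring
  -- ranges
  have hY0 : 0 ≤ Y := sum_nonneg fun i hi => mul_nonneg (by linarith [(hα i (mem_range.mp hi)).1]) (hw0 i hi)
  have hY1 : Y ≤ Δα * Pyy := by
    rw [hY, show Δα * Pyy = ∑ i ∈ range n, Δα * (ey i * cy i) by rw [mul_sum]]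
    exact sum_le_sum fun i hi => mul_le_mul_of_nonneg_right (by linarith [(hα i (mem_range.mp hi)).2]) (hw0 i hi)
  have hZ0 : 0 ≤ Z := sum_nonneg hd0
  have hZ1 : Z ≤ Δβ * Pyy := by
    rw [hZ, show Δβ * Pyy = ∑ i ∈ range n, ey i * (Δβ * cy i) by rw [mul_sum]; exact sum_congr rfl fun i _ => by ring]
    exact sum_le_sum fun i hi => mul_le_mul_of_nonneg_left (by linarith [(hcz i (mem_range.mp hi)).2]) (he i (mem_range.mp hi))
  have hX0 : 0 ≤ X := sum_nonneg fun i hi => mul_nonneg (by linarith [(hα i (mem_range.mp hi)).1]) (hd0 i hi)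
  have hX1 : X ≤ Δα * Z := by
    rw [hX, hZ, mul_sum]
    exact sum_le_sum fun i hi => mul_le_mul_of_nonneg_right (by linarith [(hα i (mem_range.mp hi)).2]) (hd0 i hi)
  have hXΨ : X ≤ Δα * Δβ * Pyy := le_trans hX1 (by nlinarith [mul_le_mul_of_nonneg_left hZ1 hΔα])
  refine ⟨⟨?_, ?_⟩, ⟨?_, ?_⟩, ⟨?_, ?_⟩, ⟨?_, ?_⟩⟩
  · rw [eY]; linarith
  · rw [eY]; linarith
  · rw [eZ]; linarith
  · rw [eZ]; linarith
  · rw [eX]; nlinarith [mul_nonneg hαl hZ0, mul_nonneg hβl hY0]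
  · rw [eX]
    nlinarith [mul_le_mul_of_nonneg_left hZ1 hαl, mul_le_mul_of_nonneg_left hY1 hβl]
  · -- `Pyy Pzz − Pyz Pzy = Pyy X − Y Z ≤ Pyy X ≤ Δα Δβ Pyy²`
    have e : Pyy * Pzz - Pyz * Pzy = Pyy * X - Y * Z := by rw [eX, eY, eZ]; ring
    rw [e]; nlinarith [mul_nonneg hY0 hZ0, mul_le_mul_of_nonneg_left hXΨ hPyy0]
  · have e : Pyz * Pzy - Pyy * Pzz = Y * Z - Pyy * X := by rw [eX, eY, eZ]; ring
    rw [e]; nlinarith [mul_le_mul hY1 hZ1 hZ0 (by positivity), mul_nonneg hPyy0 hX0]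

end Summit.QuantumFields.BalabanUV.Beta.EriceRemainderEnclosureHistoryAutonomyComparisonAgeCompositionStaticChainCrossAmplifications

end
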